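import Summits.AtomisticToContinuum.Crystallization.Theorems.FrustratedLawDichotomyDRowsArith
import Mathlib.Data.Rat.Floor
import Mathlib.Data.Rat.Cast.Order

/-!
# FrustratedLawDichotomy · crux `AperiodicFrustratedLawGap` (stmt-AtomisticToContinuum-27623) — CELL-ARITH, core:
# the exact-ℚ-in / ℤ-fixed-point-out reading kernel of the class-A/H cell K-files (decomp-a2c hand-1 g53; critic r1767 (D)(3)
# «first class-A K-file = fcc-twin R_A 4 Rc 14 via (251) `lb_le_certFloorL_trunc`, kernel `decide` style»)

The class-A/H twin of hand-2's #63 `…DRowsArith` (whose §1–§2 rounding lemmas are IMPORTED and reused, not restated).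
Conventions (#63): an integer `X` is a LOWER READING of a real `x` at scale `S : ℤ`, `0 < S`, when `(X : ℝ) ≤ S·x`, an
UPPER READING when `S·x ≤ X`.  A K-file holds its data as exact rationals (label coordinates, Gram-box corners, hence
every squared-distance window `[lo, hi]`, the coherence radius `τ`, the dials) and certifies each column of
(251) `…CellTailsRem.lb_le_certFloorL_trunc` by COMPUTABLE `ℤ`-valued functions of those rationals, evaluated by
`decide` in the kernel; this file and `…CellArithLJ` give those functions and their soundness BY NAME, so a K-file
proof is `decide` + one `exact` per column.  Here, the representation-free core:

* §1 `rdLo S x = ⌊S·x⌋`, `rdHi S x = ⌈S·x⌉` — readings of an exact rational (`rdLo_le`, `le_rdHi`);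
* §2 `mulLo`/`mulHi` (= #63's rounded products, named), `powLo`/`powHi` (iterated, any exponent) with `powLo_le`/`le_powHi`;
* §3 `ipLo S x k`/`ipHi S x k` — readings of `x⁻¹ ^ k` for a positive rational `x` (the atoms `lo⁻¹ ^ k`, `hi⁻¹ ^ k` of every
  window enclosure of (238) `…CellEnclosures`);
* §4 `scLo c X`/`scHi c X` — a reading times an exact nonnegative rational (`⌊c·X⌋`, `⌈c·X⌉`);
* §5 K-file glue: readings ⇒ real bounds after division by `S`, and list sums of readings (tables are `List`s; the `Finset`
  sums of (251) over a `Nodup` label list are `List.sum_toFinset`).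

Measured (farm, this generation): `decide +kernel` evaluates 600 exact-ℚ leaves of `forceRem`/`energyRem` size (18th
inverse powers) plus their `⌈S·⌉` readings and the `ℤ` sum in < 8 s — the kernel path is viable; heavy powers are
nevertheless routed through `ℤ` readings (`ipLo`/`ipHi`) to keep numerals at ≈ 2·log₂S bits.
Plain computable `def`s over `ℤ`/`ℚ` (no instance / notation / option); imports #63 + `Mathlib.Data.Rat.Floor/Cast.Order`; 0 sorry.  Tags: [folklore].
-/

namespace Summit.AtomisticToContinuum.Crystallization.Theorems.FrustratedLawDichotomyCellArith

open Summit.AtomisticToContinuum.Crystallization.Theorems.FrustratedLawDichotomyDRowsArith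
  (cast_fdiv_le le_cast_cdiv fdiv_nonneg fdiv_mul_le fdiv_mul_nonneg mul_le_cdiv fdiv_nat_le le_cdiv_nat)

/-! ## §1 Readings of exact rationals -/

/-- LOWER reading of the exact rational `x` at scale `S`: `⌊S·x⌋`. [folklore] -/
def rdLo (S : ℤ) (x : ℚ) : ℤ := ⌊(S : ℚ) * x⌋

/-- UPPER reading of the exact rational `x` at scale `S`: `⌈S·x⌉`. [folklore] -/
def rdHi (S : ℤ) (x : ℚ) : ℤ := ⌈(S : ℚ) * x⌉

/-- `rdLo S x ≤ S·x` over `ℝ`. [folklore] -/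
theorem rdLo_le (S : ℤ) (x : ℚ) : ((rdLo S x : ℤ) : ℝ) ≤ (S : ℝ) * (x : ℝ) := by
  have h : ((rdLo S x : ℤ) : ℚ) ≤ (S : ℚ) * x := Int.floor_le _
  have h' : (((rdLo S x : ℤ) : ℚ) : ℝ) ≤ (((S : ℚ) * x : ℚ) : ℝ) := Rat.cast_le.2 h
  simpa [Rat.cast_mul, Rat.cast_intCast] using h'

/-- `S·x ≤ rdHi S x` over `ℝ`. [folklore] -/
theorem le_rdHi (S : ℤ) (x : ℚ) : (S : ℝ) * (x : ℝ) ≤ ((rdHi S x : ℤ) : ℝ) := by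
  have h : (S : ℚ) * x ≤ ((rdHi S x : ℤ) : ℚ) := Int.le_ceil _
  have h' : (((S : ℚ) * x : ℚ) : ℝ) ≤ (((rdHi S x : ℤ) : ℚ) : ℝ) := Rat.cast_le.2 h
  simpa [Rat.cast_mul, Rat.cast_intCast] using h'

/-- a lower reading of a nonnegative rational is nonnegative (`0 ≤ S`). [folklore] -/
theorem rdLo_nonneg {S : ℤ} {x : ℚ} (hS : 0 ≤ S) (hx : 0 ≤ x) : 0 ≤ rdLo S x :=
  Int.floor_nonneg.2 (mul_nonneg (by exact_mod_cast hS) hx)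

/-- an upper reading of a nonnegative rational is nonnegative (`0 ≤ S`). [folklore] -/
theorem rdHi_nonneg {S : ℤ} {x : ℚ} (hS : 0 ≤ S) (hx : 0 ≤ x) : 0 ≤ rdHi S x :=
  le_trans (rdLo_nonneg hS hx) (Int.floor_le_ceil _)

/-! ## §2 Rounded products and powers of nonnegative readings (#63 §2, named) -/

/-- the K files' round-UP division `⌈a/b⌉ = −((−a) fdiv b)` (#63's `cdiv`). [folklore] -/
def cdiv (a b : ℤ) : ℤ := -Int.fdiv (-a) b

/-- rounded-DOWN product of two scale-`S` readings. [folklore] -/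
def mulLo (S a b : ℤ) : ℤ := Int.fdiv (a * b) S

/-- rounded-UP product of two scale-`S` readings. [folklore] -/
def mulHi (S a b : ℤ) : ℤ := cdiv (a * b) S

/-- `mulLo` of nonnegative lower readings is a lower reading of the product (#63 `fdiv_mul_le`). [folklore] -/
theorem mulLo_le {S a b : ℤ} {x y : ℝ} (hS : 0 < S) (ha0 : 0 ≤ a) (ha : (a : ℝ) ≤ S * x) (hb0 : 0 ≤ b)
    (hb : (b : ℝ) ≤ S * y) : ((mulLo S a b : ℤ) : ℝ) ≤ S * (x * y) :=
  fdiv_mul_le hS ha0 ha hb0 hb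

/-- `mulLo` of nonnegative readings is nonnegative. [folklore] -/
theorem mulLo_nonneg {S a b : ℤ} (hS : 0 < S) (ha0 : 0 ≤ a) (hb0 : 0 ≤ b) : 0 ≤ mulLo S a b :=
  fdiv_mul_nonneg hS ha0 hb0

/-- `mulHi` of upper readings of nonnegative reals is an upper reading of the product (#63 `mul_le_cdiv`). [folklore] -/
theorem le_mulHi {S a b : ℤ} {x y : ℝ} (hS : 0 < S) (hx0 : 0 ≤ x) (ha : S * x ≤ (a : ℝ)) (hy0 : 0 ≤ y)
    (hb : S * y ≤ (b : ℝ)) : S * (x * y) ≤ ((mulHi S a b : ℤ) : ℝ) :=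
  mul_le_cdiv hS hx0 ha hy0 hb

/-- iterated rounded-DOWN power of a reading: `powLo S a k` reads `x ^ k` from below (`powLo S a 0 = S` reads `1`). [folklore] -/
def powLo (S a : ℤ) : ℕ → ℤ
  | 0 => S
  | k + 1 => mulLo S (powLo S a k) a

/-- iterated rounded-UP power of a reading: `powHi S b k` reads `x ^ k` from above. [folklore] -/
def powHi (S b : ℤ) : ℕ → ℤ
  | 0 => S
  | k + 1 => mulHi S (powHi S b k) b

/-- `powLo` of a nonnegative reading is nonnegative. [folklore] -/
theorem powLo_nonneg {S a : ℤ} (hS : 0 < S) (ha0 : 0 ≤ a) : ∀ k, 0 ≤ powLo S a k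
  | 0 => hS.le
  | k + 1 => mulLo_nonneg hS (powLo_nonneg hS ha0 k) ha0

/-- ★ `powLo S a k ≤ S·x^k` for a nonnegative lower reading `a` of `x`. [folklore] -/
theorem powLo_le {S a : ℤ} {x : ℝ} (hS : 0 < S) (ha0 : 0 ≤ a) (ha : (a : ℝ) ≤ S * x) :
    ∀ k, ((powLo S a k : ℤ) : ℝ) ≤ S * x ^ k
  | 0 => by simp [powLo]
  | k + 1 => by
    rw [powLo, pow_succ]
    exact mulLo_le hS (powLo_nonneg hS ha0 k) (powLo_le hS ha0 ha k) ha0 ha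

/-- ★ `S·x^k ≤ powHi S b k` for an upper reading `b` of `x ≥ 0`. [folklore] -/
theorem le_powHi {S b : ℤ} {x : ℝ} (hS : 0 < S) (hx : 0 ≤ x) (hb : S * x ≤ (b : ℝ)) :
    ∀ k, S * x ^ k ≤ ((powHi S b k : ℤ) : ℝ)
  | 0 => by simp [powHi]
  | k + 1 => by
    rw [powHi, pow_succ]
    exact le_mulHi hS (pow_nonneg hx k) (le_powHi hS hx hb k) hx hb

/-! ## §3 Inverse powers of a positive exact rational -/

/-- LOWER reading of `x⁻¹ ^ k` for an exact positive rational `x`. [folklore] -/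
def ipLo (S : ℤ) (x : ℚ) (k : ℕ) : ℤ := powLo S (rdLo S x⁻¹) k

/-- UPPER reading of `x⁻¹ ^ k` for an exact positive rational `x`. [folklore] -/
def ipHi (S : ℤ) (x : ℚ) (k : ℕ) : ℤ := powHi S (rdHi S x⁻¹) k

/-- `ipLo` is nonnegative. [folklore] -/
theorem ipLo_nonneg {S : ℤ} {x : ℚ} (hS : 0 < S) (hx : 0 < x) (k : ℕ) : 0 ≤ ipLo S x k :=
  powLo_nonneg hS (rdLo_nonneg hS.le (inv_nonneg.2 hx.le)) k

/-- ★ `ipLo S x k ≤ S·x⁻¹^k`. [folklore] -/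
theorem ipLo_le {S : ℤ} {x : ℚ} (hS : 0 < S) (hx : 0 < x) (k : ℕ) :
    ((ipLo S x k : ℤ) : ℝ) ≤ S * ((x : ℝ)⁻¹ ^ k) := by
  have h := rdLo_le S x⁻¹
  rw [Rat.cast_inv] at h
  exact powLo_le hS (rdLo_nonneg hS.le (inv_nonneg.2 hx.le)) h k

/-- ★ `S·x⁻¹^k ≤ ipHi S x k`. [folklore] -/
theorem le_ipHi {S : ℤ} {x : ℚ} (hS : 0 < S) (hx : 0 < x) (k : ℕ) :
    S * ((x : ℝ)⁻¹ ^ k) ≤ ((ipHi S x k : ℤ) : ℝ) := by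
  have h := le_rdHi S x⁻¹
  rw [Rat.cast_inv] at h
  have hx' : (0 : ℝ) ≤ (x : ℝ)⁻¹ := inv_nonneg.2 (by exact_mod_cast hx.le)
  exact le_powHi hS hx' h k

/-- `0 ≤ ipHi` (an upper reading of a nonnegative quantity at positive scale). [folklore] -/
theorem ipHi_nonneg {S : ℤ} {x : ℚ} (hS : 0 < S) (hx : 0 < x) (k : ℕ) : 0 ≤ ipHi S x k := by
  have h := le_ipHi hS hx k
  have h0 : (0 : ℝ) ≤ S * ((x : ℝ)⁻¹ ^ k) :=
    mul_nonneg (by exact_mod_cast hS.le) (pow_nonneg (inv_nonneg.2 (by exact_mod_cast hx.le)) k)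
  exact_mod_cast h0.trans h

/-! ## §4 A reading times an exact nonnegative rational -/

/-- `⌊c·X⌋`: lower reading of `c·x` from a lower reading `X` of `x`, `0 ≤ c` exact. [folklore] -/
def scLo (c : ℚ) (X : ℤ) : ℤ := ⌊c * (X : ℚ)⌋

/-- `⌈c·X⌉`: upper reading of `c·x` from an upper reading `X` of `x`, `0 ≤ c` exact. [folklore] -/
def scHi (c : ℚ) (X : ℤ) : ℤ := ⌈c * (X : ℚ)⌉

/-- ★ `scLo c X ≤ S·(c·x)`. [folklore] -/
theorem scLo_le {c : ℚ} {S X : ℤ} {x : ℝ} (hc : 0 ≤ c) (hX : (X : ℝ) ≤ S * x) :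
    ((scLo c X : ℤ) : ℝ) ≤ S * ((c : ℝ) * x) := by
  have h1 : ((scLo c X : ℤ) : ℝ) ≤ (c : ℝ) * (X : ℝ) := by
    have h : ((scLo c X : ℤ) : ℚ) ≤ c * (X : ℚ) := Int.floor_le _
    have h' : (((scLo c X : ℤ) : ℚ) : ℝ) ≤ ((c * (X : ℚ) : ℚ) : ℝ) := Rat.cast_le.2 h
    simpa [Rat.cast_mul, Rat.cast_intCast] using h'
  have h2 : (c : ℝ) * (X : ℝ) ≤ (c : ℝ) * (S * x) := mul_le_mul_of_nonneg_left hX (by exact_mod_cast hc)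
  calc ((scLo c X : ℤ) : ℝ) ≤ (c : ℝ) * (S * x) := h1.trans h2
    _ = S * ((c : ℝ) * x) := by ring

/-- ★ `S·(c·x) ≤ scHi c X`. [folklore] -/
theorem le_scHi {c : ℚ} {S X : ℤ} {x : ℝ} (hc : 0 ≤ c) (hX : S * x ≤ (X : ℝ)) :
    S * ((c : ℝ) * x) ≤ ((scHi c X : ℤ) : ℝ) := by
  have h1 : (c : ℝ) * (X : ℝ) ≤ ((scHi c X : ℤ) : ℝ) := by
    have h : c * (X : ℚ) ≤ ((scHi c X : ℤ) : ℚ) := Int.le_ceil _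
    have h' : ((c * (X : ℚ) : ℚ) : ℝ) ≤ (((scHi c X : ℤ) : ℚ) : ℝ) := Rat.cast_le.2 h
    simpa [Rat.cast_mul, Rat.cast_intCast] using h'
  have h2 : (c : ℝ) * (S * x) ≤ (c : ℝ) * (X : ℝ) := mul_le_mul_of_nonneg_left hX (by exact_mod_cast hc)
  calc S * ((c : ℝ) * x) = (c : ℝ) * (S * x) := by ring
    _ ≤ ((scHi c X : ℤ) : ℝ) := h2.trans h1

/-- `scHi` of a nonnegative reading by a nonnegative rational is nonnegative. [folklore] -/
theorem scHi_nonneg {c : ℚ} {X : ℤ} (hc : 0 ≤ c) (hX : 0 ≤ X) : 0 ≤ scHi c X :=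
  le_trans (Int.floor_nonneg.2 (mul_nonneg hc (by exact_mod_cast hX))) (Int.floor_le_ceil _)

/-- upper reading of `max x y` from upper readings (`max` is monotone). [folklore] -/
theorem max_le_max_readings {S A B : ℤ} {x y : ℝ} (hA : S * x ≤ (A : ℝ)) (hB : S * y ≤ (B : ℝ)) (hS : 0 ≤ S) :
    S * max x y ≤ ((max A B : ℤ) : ℝ) := by
  have hS' : (0 : ℝ) ≤ S := by exact_mod_cast hS
  rcases le_total x y with h | h
  · rw [max_eq_right h]; exact hB.trans (by exact_mod_cast le_max_right A B)
  · rw [max_eq_left h]; exact hA.trans (by exact_mod_cast le_max_left A B)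

/-- upper reading of `max 0 x` from an upper reading of `x`. [folklore] -/
theorem max_zero_le_reading {S A : ℤ} {x : ℝ} (hA : S * x ≤ (A : ℝ)) (hS : 0 ≤ S) :
    S * max 0 x ≤ ((max 0 A : ℤ) : ℝ) := by
  have := max_le_max_readings (x := 0) (A := 0) (by simp) hA hS
  simpa using this

/-! ## §5 K-file glue: back to real bounds, and list sums of readings -/

/-- a lower reading divided by the scale is a real lower bound. [folklore] -/
theorem div_le_of_reading {S X : ℤ} {x : ℝ} (hS : 0 < S) (h : (X : ℝ) ≤ S * x) : (X : ℝ) / S ≤ x := by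
  have hS' : (0 : ℝ) < S := by exact_mod_cast hS
  rw [div_le_iff₀ hS']; linarith

/-- an upper reading divided by the scale is a real upper bound. [folklore] -/
theorem le_div_of_reading {S X : ℤ} {x : ℝ} (hS : 0 < S) (h : S * x ≤ (X : ℝ)) : x ≤ (X : ℝ) / S := by
  have hS' : (0 : ℝ) < S := by exact_mod_cast hS
  rw [le_div_iff₀ hS']; linarith

/-- ★ a table of lower readings sums to a lower reading of the sum (tables and label sets as lists). [folklore] -/
theorem list_sum_readings_le {ι : Type*} (S : ℤ) (T : ι → ℤ) (f : ι → ℝ) :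
    ∀ l : List ι, (∀ m ∈ l, ((T m : ℤ) : ℝ) ≤ S * f m) → (((l.map T).sum : ℤ) : ℝ) ≤ S * (l.map f).sum
  | [], _ => by simp
  | m :: l, h => by
    simp only [List.map_cons, List.sum_cons, Int.cast_add]
    have h1 := h m (by simp)
    have h2 := list_sum_readings_le S T f l fun m' hm' => h m' (by simp [hm'])
    rw [mul_add]; exact add_le_add h1 h2

/-- ★ a table of upper readings sums to an upper reading of the sum. [folklore] -/
theorem le_list_sum_readings {ι : Type*} (S : ℤ) (T : ι → ℤ) (f : ι → ℝ) :
    ∀ l : List ι, (∀ m ∈ l, S * f m ≤ ((T m : ℤ) : ℝ)) → S * (l.map f).sum ≤ (((l.map T).sum : ℤ) : ℝ)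
  | [], _ => by simp
  | m :: l, h => by
    simp only [List.map_cons, List.sum_cons, Int.cast_add]
    have h1 := h m (by simp)
    have h2 := le_list_sum_readings S T f l fun m' hm' => h m' (by simp [hm'])
    rw [mul_add]; exact add_le_add h1 h2

/-- the `Finset` sums of (251) over a duplicate-free label LIST are list sums (Mathlib `List.sum_toFinset`, recorded in the
K-file's shape). [folklore] -/
theorem finsetSum_eq_listSum {ι : Type*} [DecidableEq ι] {l : List ι} (hl : l.Nodup) (f : ι → ℝ) :
    ∑ m ∈ l.toFinset, f m = (l.map f).sum :=
  List.sum_toFinset f hl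

/-- ★ square-root BY WITNESS (the K files never evaluate a root): a rational `b ≥ 0` with `g ≤ b·b` checked in `ℚ` bounds
`√g`-type quantities through `x² ≤ g ⇒ x ≤ b` — stated as the real implication the norm lemmas of (252)/(238) consume. [folklore] -/
theorem le_of_sq_le_witness {x g : ℝ} {b : ℚ} (hb : 0 ≤ b) (hg : x ^ 2 ≤ g) (hw : g ≤ ((b * b : ℚ) : ℝ)) :
    x ≤ (b : ℝ) := by
  have hb' : (0 : ℝ) ≤ (b : ℝ) := by exact_mod_cast hb
  have h : x ^ 2 ≤ (b : ℝ) ^ 2 := by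
    have e : ((b * b : ℚ) : ℝ) = (b : ℝ) ^ 2 := by push_cast; ring
    rw [e] at hw
    exact hg.trans hw
  exact (abs_le_of_sq_le_sq' h hb').2

end Summit.AtomisticToContinuum.Crystallization.Theorems.FrustratedLawDichotomyCellArith
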